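import Summits.BirchSwinnertonDyer.Rank1Residual.GaloisImage.KolyvaginCongruenceRat
import Summits.BirchSwinnertonDyer.Rank1Residual.GaloisImage.KolyvaginCongruenceTransport
import HarnessLib

/-!
# The Kolyvagin congruence for `T_p E` over the cyclotomic levels of `ℚ`: descent to the bottom
# layer and transport through `D_r` — file C0f of THEOREM C of row T-DER
# (cell `b2b-bsdres`, team n1011, seat p11 GEN 9, OWNERS row T-DER = skel/T-DER.md STATUS v8 (v8-2),
# referee-1 GEN 35 ACK-1 provisos (ii)–(iv), (vii))

HONEST FRAMING (cell `b2b-bsdres`, run/shared/lean/b2b/bsd-rank1-residual/, verbatim in every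
file): the goal of the cell is to DELETE the COMBINATION-SHAPED residual classes of the
Birch–Swinnerton-Dyer formula for ALL analytic-rank `≤ 1` elliptic curves over `ℚ` — "full BSD
formula for every rank `≤ 1` curve in class `C`" assembled STRICTLY from published theorems — so
that the rank-`≤ 1` remainder becomes exactly the CONSTRUCTION-SHAPED classes, which are TYPED
(missing-input `Prop`s), NOT attempted. This is not "finishing BSD". Team n1011: research route on
the CONSTRUCTION-SHAPED class X4 / §I N11 (route-1 PORT, (P-DER)); TOOL theorem: NO Euler system is
asserted to exist (it is the hypothesis `hc`), no definition, no named fact, no `sorry`.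

## What ([PerrinRiou98] Prop. 2.2.5 (ii), bottom layer, all `λ ∣ q`, for `T_p E` over `ℚ`)

Continuation of `KolyvaginCongruenceRat` (the congruence at the layer `r₀ = v_p(q′^f − 1)` for one
Frobenius datum `(𝔔, φ)`).  Here:
* `exists_sub_eq_sub_one_apply_frobenius_pow_bot` — **the congruence at the bottom layer `⊥`**
  (`ℚ(μ_{rq})`, `ℚ(μ_r)`, where Kolyvagin's derivative classes live): for ALL representatives `x'`
  of `c_{⊥,rq}`, `x` of `c_{⊥,r}`, `x'(φ^f) − Z_φ x(φ^f) ∈ (ρ(φ^f) − 1) T_p E`.  Proof: C0d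
  `Congruence.exists_sub_eq_sub_one_apply_of_eulerSystem_bot` (`IsEulerSystem.cores_p` from `⊥` to
  `r₀`, BY NAME) with the generator `γ` of `Gal(ℚ(μ_{p^{r₀}})/ℚ)` (n1011-p15 CK-1a
  `Rat.exists_generator_level_bot`, `p` odd) and, at each conjugate prime `γ^{-j}𝔔`, the layer-`r₀`
  congruence of `KolyvaginCongruenceRat` for the conjugate Frobenius `γ^{-j}φγ^j` (Mathlib
  `IsArithFrobAt.conj`).  The operator is a FUNCTION `Z_·` of the Frobenius with three displayed
  properties (`hZf`: `P(ψ⁻¹|T*;ψ⁻¹) = (q′−1)•Z_ψ` — K4; `hZfc`: `Z_ψ` commutes with `ρ(ψ)`;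
  `hZfconj`: `Z_{w⁻¹ψw} = ρ(w)⁻¹Z_ψρ(w)`), instantiated by K4's `q′⁻¹ρ(ψ)⁻²(a_q ρ(ψ) − q′ − 1)` in
  the
  THEOREM C END.
* `cong_noncommProd_deriv_frobenius_pow_bot` — **the congruence for the DERIVED classes
  `(D_r c_{⊥,rq}, D_r c_{⊥,r})`** at every datum of the conjugation-stable family
  `S φ₁ Z := ∃ 𝔔 ∣ q, ∃ φ Frobenius at 𝔔 fixing μ_{q′}, φ₁ = φ^f ∧ Z = Z_φ` (G3
  `Congruence.cong_noncommProd_deriv`) — the `hcong` input of THEOREM C's generic END (G2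
  `Derivative.apply_eq_aeval_apply_of_congruence`) for Kato-type Euler systems.
0 defs, 0 facts.

References: B. Perrin-Riou, Ann. Inst. Fourier 48 (1998), Prop. 2.2.5 (ii); K. Rubin, *Euler
Systems* (2000), §4.8, Cor. 4.8.1; C.-H. Kim, arXiv:2203.12159, §1.2.2.
-/

noncomputable section

open CategoryTheory Function Finset Polynomial Field IsDedekindDomain
open scoped NumberField Pointwise
open Literature.NumberTheory.GaloisRepresentations Literature.NumberTheory.EllipticCurves
open Literature.NumberTheory.EllipticCurves (subgroupConj subgroupConj_apply_coe)
open Summit.BirchSwinnertonDyer.Rank1Residual.GaloisImage.CyclotomicLevel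
open Rat.HeightOneSpectrum

universe u

namespace Summit.BirchSwinnertonDyer.Rank1Residual.GaloisImage

namespace Congruence

namespace Rat

/-! ### §1 Conjugate Frobenius data -/

section Conj

variable {G : Type u} [Group G]

/-- `(w⁻¹ φ w)^f = w⁻¹ φ^f w`. [folklore] -/
theorem inv_mul_mul_pow (w φ : G) (f : ℕ) : (w⁻¹ * φ * w) ^ f = w⁻¹ * φ ^ f * w := by
  have h := (conj_pow (a := w⁻¹) (b := φ) (i := f))
  rwa [inv_inv] at h

end Conj

variable (W : WeierstrassCurve ℚ) [W.IsElliptic] [W.IsGloballyMinimal] {p : ℕ} [Fact p.Prime]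
variable [Module.Free ℤ_[p] (W.tateModule p)] [Module.Finite ℤ_[p] (W.tateModule p)]
  [ContinuousSMul ℤ_[p] (W.tateModule p)]
variable (S : Set (HeightOneSpectrum (𝓞 ℚ)))

/-! ### §2 The congruence at the bottom layer -/

/-- **The Kolyvagin congruence at the bottom layer** for `T_p E` over `cyclotomicLevelsRat p S`
([PerrinRiou98] Prop. 2.2.5 (ii): `c(mℓ)_λ = Z(λ) c(m)_λ` for ALL `λ ∣ ℓ`, read at the Frobenius
`φ^f` of `ℚ(μ_{rq})_𝔔`).  Binders as in `exists_sub_eq_sub_one_apply_frobenius_pow_level`, with the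
operator a function `Zf` of the Frobenius (`hZf`, `hZfc`, `hZfconj`, see the module docstring).
Uses `IsEulerSystem.cores_p` (`⊥ ≤ r₀`) and, through the layer-`r₀` theorem, `cores_p` (`r₀ ≤ 2r₀`)
and `cores_cons`, all BY NAME. [cite: PerrinRiou1998AIF, Prop. 2.2.5 (ii)] -/
theorem exists_sub_eq_sub_one_apply_frobenius_pow_bot (hp2 : p ≠ 2)
    {c : ∀ (i : ℕ) (r : (cyclotomicLevelsRat p S).Ideals),
      H1 (W.tateGaloisRep p (W.continuous_galoisRepTate_holds p)) ((cyclotomicLevelsRat p S).level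
          i r.1)}
    (hc : IsEulerSystem (cyclotomicLevelsRat p S)
      (W.tateGaloisRep p (W.continuous_galoisRepTate_holds p)) p c)
    {k : ℕ} (hk : 0 < k) (r : (cyclotomicLevelsRat p S).Ideals) {q : HeightOneSpectrum (𝓞 ℚ)}
    (hq : q ∈ (cyclotomicLevelsRat p S).primes) (hqr : q ∉ r.1)
    (hKol : Kato.IsKolyvaginPrime W p k ((primesEquiv q : Nat.Primes) : ℕ))
    {𝔔 : Ideal (absIntegers (𝓞 ℚ) ℚ)} (h𝔔 : 𝔔 ∈ q.primesAbove)
    {φ : absoluteGaloisGroup ℚ} (hφ : IsArithFrobAt (𝓞 ℚ) φ 𝔔)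
    (hφq : φ ∈ (cyclotomicLevelsRat p S).tameLevel q)
    {f r₀ : ℕ} (hf : f ≠ 0)
    (hft : ∀ ℓ ∈ r.1, ((primesEquiv q : Nat.Primes) : ℕ) ^ f ≡ 1 [MOD ((primesEquiv ℓ :
        Nat.Primes) : ℕ)])
    (hfp : p ∣ ((primesEquiv q : Nat.Primes) : ℕ) ^ f - 1)
    (hr₀ : padicValNat p (((primesEquiv q : Nat.Primes) : ℕ) ^ f - 1) = r₀)
    (hφ₀ : φ ^ f ∈ (cyclotomicLevelsRat p S).level ⊥ (r.cons q hq).1)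
    (Zf : absoluteGaloisGroup ℚ → (W.tateModule p →ₗ[ℤ_[p]] W.tateModule p))
    (hZfc : ∀ ψ, IsArithFrobAtPlace ℚ q ψ → Commute (W.galoisRepTate p ψ) (Zf ψ))
    (hZf : ∀ ψ, IsArithFrobAtPlace ℚ q ψ → ∀ t : W.tateModule p,
      aeval (W.galoisRepTate p ψ⁻¹)
        (rubinEulerFactor (W.galoisRepTate p) (cyclotomicCharacterToUnits ℚ p ℤ_[p]) ψ) t =
      ((((primesEquiv q : Nat.Primes) : ℕ) - 1 : ℕ) : ℤ_[p]) • Zf ψ t)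
    (hZfconj : ∀ (ψ w : absoluteGaloisGroup ℚ) (t : W.tateModule p),
      Zf (w⁻¹ * ψ * w) t = W.galoisRepTate p w⁻¹ (Zf ψ (W.galoisRepTate p w t)))
    (x₀' : contOneCocycles (subgroupRep (W.tateGaloisRep p (W.continuous_galoisRepTate_holds
        p)).toTopRep
      ((cyclotomicLevelsRat p S).level ⊥ (r.cons q hq).1)))
    (hx₀' : oneCocycleClass _ x₀' = c ⊥ (r.cons q hq))
    (x₀ : contOneCocycles (subgroupRep (W.tateGaloisRep p (W.continuous_galoisRepTate_holds
        p)).toTopRep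
      ((cyclotomicLevelsRat p S).level ⊥ r.1)))
    (hx₀ : oneCocycleClass _ x₀ = c ⊥ r) :
    ∃ w : W.tateModule p, x₀'.1 ⟨φ ^ f, hφ₀⟩ -
        Zf φ (x₀.1 ⟨φ ^ f, (cyclotomicLevelsRat p S).level_insert_le ⊥ r.1 q hφ₀⟩) =
      W.galoisRepTate p (φ ^ f) w - w := by
  classical
  haveI hN : ((cyclotomicLevelsRat p S).tameLevel q).Normal :=
    Subgroup.Normal.of_commutator_le _ ((cyclotomicLevelsRat p S).commutator_le_tameLevel q)
  have hφP : IsArithFrobAtPlace ℚ q φ := ⟨𝔔, h𝔔, hφ⟩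
  have hr₀pos : 0 < r₀ := by
    rw [← hr₀]
    exact one_le_padicValNat_of_dvd (Nat.sub_ne_zero_of_lt
      (CyclotomicLevel.Rat.one_lt_primesEquiv_pow q hf)) hfp
  -- `φ^f` at the layer `r₀`
  have hft' : ∀ ℓ ∈ (r.cons q hq).1, ℓ ≠ q →
      ((primesEquiv q : Nat.Primes) : ℕ) ^ f ≡ 1 [MOD ((primesEquiv ℓ : Nat.Primes) : ℕ)] := by
    intro ℓ hℓ hℓq
    change ℓ ∈ insert q r.1 at hℓ
    rcases Finset.mem_insert.mp hℓ with rfl | hℓ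
    · exact absurd rfl hℓq
    · exact hft ℓ hℓ
  have hφr₀ : φ ^ f ∈ (cyclotomicLevelsRat p S).level r₀ (r.cons q hq).1 :=
    CyclotomicLevel.Rat.frobenius_pow_mem_level hq hφP hφq _ hft'
      (CyclotomicLevel.Rat.primesEquiv_pow_modEq_one_of_padicValNat_eq q hr₀)
  -- the generator `γ` of the `p`-direction over the tame levels (CK-1a)
  obtain ⟨γ, hγmem, hγ⟩ := CyclotomicLevel.Rat.exists_generator_level_bot S hp2 hr₀pos
  obtain ⟨hcovγ', hinjγ'⟩ := hγ (r.cons q hq).1 (r.cons q hq).2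
  obtain ⟨hcovγ, hinjγ⟩ := hγ r.1 r.2
  -- `Z_φ` commutes with `ρ(φ^f)`
  have hZφ : ∀ t : W.tateModule p,
      Zf φ ((W.tateGaloisRep p (W.continuous_galoisRepTate_holds p)).toTopRep.ρ (φ ^ f) t) =
        (W.tateGaloisRep p (W.continuous_galoisRepTate_holds p)).toTopRep.ρ (φ ^ f) (Zf φ t) := by
    intro t
    have h := ((hZfc φ hφP).pow_left f).eq
    have h' := congrArg (fun F : Module.End ℤ_[p] (W.tateModule p) => F t) h
    change Zf φ (W.galoisRepTate p (φ ^ f) t) = W.galoisRepTate p (φ ^ f) (Zf φ t)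
    simp only [Module.End.mul_apply, map_pow] at h' ⊢
    exact h'.symm
  -- C0d `_bot`
  refine exists_sub_eq_sub_one_apply_of_eulerSystem_bot hc r₀ r q hq γ _ (hγmem _ (r.cons q hq).2)
    hcovγ' hinjγ' hcovγ hinjγ (φ ^ f) hφr₀ (Zf φ) hZφ ?_ x₀' hx₀' x₀ hx₀
  -- the layer-`r₀` congruence at the conjugate data `γ^{-j}`
  intro j _ h₁ h₂ xr' xr hxr' hxr
  have h𝔔j : (γ ^ j)⁻¹ • 𝔔 ∈ q.primesAbove := smul_mem_primesAbove h𝔔 _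
  have hφj : IsArithFrobAt (𝓞 ℚ) ((γ ^ j)⁻¹ * φ * γ ^ j) ((γ ^ j)⁻¹ • 𝔔) := by
    have h := hφ.conj (γ ^ j)⁻¹
    rwa [inv_inv] at h
  have hφqj : (γ ^ j)⁻¹ * φ * γ ^ j ∈ (cyclotomicLevelsRat p S).tameLevel q := by
    have h := hN.conj_mem φ hφq (γ ^ j)⁻¹
    rwa [inv_inv] at h
  have hpow : ((γ ^ j)⁻¹ * φ * γ ^ j) ^ f = (γ ^ j)⁻¹ * φ ^ f * γ ^ j := inv_mul_mul_pow _ _ _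
  have hφ₀j : ((γ ^ j)⁻¹ * φ * γ ^ j) ^ f ∈ (cyclotomicLevelsRat p S).level r₀ (r.cons q hq).1 := by
    rw [hpow]; exact h₁
  have hφPj : IsArithFrobAtPlace ℚ q ((γ ^ j)⁻¹ * φ * γ ^ j) := ⟨_, h𝔔j, hφj⟩
  obtain ⟨w', hw'⟩ := exists_sub_eq_sub_one_apply_frobenius_pow_level W S hp2 hc hk r hq hqr hKol
    h𝔔j hφj hφqj hf hft hfp hr₀ hφ₀j (Zf _) (hZfc _ hφPj) (hZf _ hφPj) xr' hxr' xr hxr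
  refine ⟨w', ?_⟩
  have e1 : (⟨((γ ^ j)⁻¹ * φ * γ ^ j) ^ f, hφ₀j⟩ : (cyclotomicLevelsRat p S).level r₀ (r.cons q
      hq).1) =
      ⟨(γ ^ j)⁻¹ * φ ^ f * γ ^ j, h₁⟩ := Subtype.ext hpow
  have e2 : (⟨((γ ^ j)⁻¹ * φ * γ ^ j) ^ f,
      (cyclotomicLevelsRat p S).level_insert_le r₀ r.1 q hφ₀j⟩ : (cyclotomicLevelsRat p S).level
          r₀ r.1) =
      ⟨(γ ^ j)⁻¹ * φ ^ f * γ ^ j, h₂⟩ := Subtype.ext hpow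
  rw [e1, e2, hZfconj, hpow] at hw'
  exact hw'

/-! ### §3 The congruence for the derived classes `(D_r c_{⊥,rq}, D_r c_{⊥,r})` -/

/-- **The Kolyvagin congruence for `(D_r c_{⊥,rq}, D_r c_{⊥,r})`** at every datum of the
conjugation-stable family `S φ₁ Z := ∃ 𝔔 ∣ q, ∃ φ, φ Frobenius at 𝔔 fixing μ_{q′}, φ₁ = φ^f,
Z = Z_φ`, for ALL representatives: the `hcong` input of THEOREM C's generic END (G2
`Derivative.apply_eq_aeval_apply_of_congruence`) for an Euler system of `T_p E` over
`cyclotomicLevelsRat p S`.  From `exists_sub_eq_sub_one_apply_frobenius_pow_bot` by G3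
`Congruence.cong_noncommProd_deriv` (the derivative operators `D_ℓ = Σ_{j<N_ℓ} j σ_ℓ^j` on
`H¹(ℚ(μ_{rq}), T)` and `H¹(ℚ(μ_r), T)` built from the SAME `σ_ℓ`, any commutation proofs).
[cite: PerrinRiou1998AIF, Prop. 2.2.5 (ii)] [cite: Rubin2000, Def. 4.4.1 and Cor. 4.8.1] -/
theorem cong_noncommProd_deriv_frobenius_pow_bot (hp2 : p ≠ 2)
    {c : ∀ (i : ℕ) (r : (cyclotomicLevelsRat p S).Ideals),
      H1 (W.tateGaloisRep p (W.continuous_galoisRepTate_holds p)) ((cyclotomicLevelsRat p S).level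
          i r.1)}
    (hc : IsEulerSystem (cyclotomicLevelsRat p S)
      (W.tateGaloisRep p (W.continuous_galoisRepTate_holds p)) p c)
    {k : ℕ} (hk : 0 < k) (r : (cyclotomicLevelsRat p S).Ideals) {q : HeightOneSpectrum (𝓞 ℚ)}
    (hq : q ∈ (cyclotomicLevelsRat p S).primes) (hqr : q ∉ r.1)
    (hKol : Kato.IsKolyvaginPrime W p k ((primesEquiv q : Nat.Primes) : ℕ))
    {f r₀ : ℕ} (hf : f ≠ 0)
    (hft : ∀ ℓ ∈ r.1, ((primesEquiv q : Nat.Primes) : ℕ) ^ f ≡ 1 [MOD ((primesEquiv ℓ :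
        Nat.Primes) : ℕ)])
    (hfp : p ∣ ((primesEquiv q : Nat.Primes) : ℕ) ^ f - 1)
    (hr₀ : padicValNat p (((primesEquiv q : Nat.Primes) : ℕ) ^ f - 1) = r₀)
    (Zf : absoluteGaloisGroup ℚ → (W.tateModule p →ₗ[ℤ_[p]] W.tateModule p))
    (hZfc : ∀ ψ, IsArithFrobAtPlace ℚ q ψ → Commute (W.galoisRepTate p ψ) (Zf ψ))
    (hZf : ∀ ψ, IsArithFrobAtPlace ℚ q ψ → ∀ t : W.tateModule p,
      aeval (W.galoisRepTate p ψ⁻¹)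
        (rubinEulerFactor (W.galoisRepTate p) (cyclotomicCharacterToUnits ℚ p ℤ_[p]) ψ) t =
      ((((primesEquiv q : Nat.Primes) : ℕ) - 1 : ℕ) : ℤ_[p]) • Zf ψ t)
    (hZfconj : ∀ (ψ w : absoluteGaloisGroup ℚ) (t : W.tateModule p),
      Zf (w⁻¹ * ψ * w) t = W.galoisRepTate p w⁻¹ (Zf ψ (W.galoisRepTate p w t)))
    (σ : HeightOneSpectrum (𝓞 ℚ) → absoluteGaloisGroup ℚ) (Nℓ : HeightOneSpectrum (𝓞 ℚ) → ℕ)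
    (comm) (comm') :
    ∀ (φ₁ : absoluteGaloisGroup ℚ) (hφ₁ : φ₁ ∈ (cyclotomicLevelsRat p S).level ⊥ (r.cons q hq).1)
      (Z : W.tateModule p →ₗ[ℤ_[p]] W.tateModule p),
      (∃ 𝔔 ∈ q.primesAbove, ∃ φ : absoluteGaloisGroup ℚ, IsArithFrobAt (𝓞 ℚ) φ 𝔔 ∧
        φ ∈ (cyclotomicLevelsRat p S).tameLevel q ∧ φ₁ = φ ^ f ∧ Z = Zf φ) →
      ∀ (x₁ : contOneCocycles (subgroupRep (W.tateGaloisRep p (W.continuous_galoisRepTate_holds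
          p)).toTopRep
          ((cyclotomicLevelsRat p S).level ⊥ (r.cons q hq).1)))
        (x₀ : contOneCocycles (subgroupRep (W.tateGaloisRep p (W.continuous_galoisRepTate_holds
            p)).toTopRep
          ((cyclotomicLevelsRat p S).level ⊥ r.1))),
        oneCocycleClass _ x₁ = (r.1.noncommProd (fun ℓ => ∑ j ∈ range (Nℓ ℓ),
            (j : Module.End ℤ_[p] (continuousCohomology 1 (subgroupRep
              (W.tateGaloisRep p (W.continuous_galoisRepTate_holds p)).toTopRep
              ((cyclotomicLevelsRat p S).level ⊥ (r.cons q hq).1)))) *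
              (conjMap (W.tateGaloisRep p (W.continuous_galoisRepTate_holds p)).toTopRep
                ((cyclotomicLevelsRat p S).level ⊥ (r.cons q hq).1) (σ ℓ) 1).hom.toLinearMap ^ j)
                    comm)
            (c ⊥ (r.cons q hq)) →
        oneCocycleClass _ x₀ = (r.1.noncommProd (fun ℓ => ∑ j ∈ range (Nℓ ℓ),
            (j : Module.End ℤ_[p] (continuousCohomology 1 (subgroupRep
              (W.tateGaloisRep p (W.continuous_galoisRepTate_holds p)).toTopRep
              ((cyclotomicLevelsRat p S).level ⊥ r.1)))) *
              (conjMap (W.tateGaloisRep p (W.continuous_galoisRepTate_holds p)).toTopRep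
                ((cyclotomicLevelsRat p S).level ⊥ r.1) (σ ℓ) 1).hom.toLinearMap ^ j) comm') (c ⊥
                    r) →
          ∃ t : W.tateModule p, x₁.1 ⟨φ₁, hφ₁⟩ -
              Z (x₀.1 ⟨φ₁, (cyclotomicLevelsRat p S).level_insert_le ⊥ r.1 q hφ₁⟩) =
            (W.tateGaloisRep p (W.continuous_galoisRepTate_holds p)).toTopRep.ρ φ₁ t - t := by
  classical
  haveI hN : ((cyclotomicLevelsRat p S).tameLevel q).Normal :=
    Subgroup.Normal.of_commutator_le _ ((cyclotomicLevelsRat p S).commutator_le_tameLevel q)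
  refine cong_noncommProd_deriv (W.tateGaloisRep p (W.continuous_galoisRepTate_holds p)).toTopRep
    ((cyclotomicLevelsRat p S).level ⊥ (r.cons q hq).1) ((cyclotomicLevelsRat p S).level ⊥ r.1)
    ((cyclotomicLevelsRat p S).level_insert_le ⊥ r.1 q)
    (fun φ₁ Z => ∃ 𝔔 ∈ q.primesAbove, ∃ φ : absoluteGaloisGroup ℚ, IsArithFrobAt (𝓞 ℚ) φ 𝔔 ∧
        φ ∈ (cyclotomicLevelsRat p S).tameLevel q ∧ φ₁ = φ ^ f ∧ Z = Zf φ)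
    ?_ ?_ σ Nℓ r.1 comm comm' (c ⊥ (r.cons q hq)) (c ⊥ r) ?_
  · -- `S` is conjugation-stable
    rintro φ₁ Z w ⟨𝔔, h𝔔, φ, hφ, hφq, rfl, rfl⟩
    refine ⟨w⁻¹ • 𝔔, smul_mem_primesAbove h𝔔 _, w⁻¹ * φ * w, ?_, ?_, (inv_mul_mul_pow w φ f).symm,
        ?_⟩
    · have h := hφ.conj w⁻¹
      rwa [inv_inv] at h
    · have h := hN.conj_mem φ hφq w⁻¹
      rwa [inv_inv] at h
    · refine LinearMap.ext fun t => ?_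
      rw [hZfconj]
      rfl
  · -- `Z` commutes with `ρ(φ₁)` on `S`
    rintro φ₁ Z ⟨𝔔, h𝔔, φ, hφ, hφq, rfl, rfl⟩ t
    have h := ((hZfc φ ⟨𝔔, h𝔔, hφ⟩).pow_left f).eq
    have h' := congrArg (fun F : Module.End ℤ_[p] (W.tateModule p) => F t) h
    change Zf φ (W.galoisRepTate p (φ ^ f) t) = W.galoisRepTate p (φ ^ f) (Zf φ t)
    simp only [Module.End.mul_apply, map_pow] at h' ⊢
    exact h'.symm
  · -- the congruence for `(c_{⊥,rq}, c_{⊥,r})` at every datum of `S`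
    rintro φ₁ hφ₁ Z ⟨𝔔, h𝔔, φ, hφ, hφq, rfl, rfl⟩ x₁ x₀ hx₁ hx₀
    exact exists_sub_eq_sub_one_apply_frobenius_pow_bot W S hp2 hc hk r hq hqr hKol h𝔔 hφ hφq hf hft
      hfp hr₀ hφ₁ Zf hZfc hZf hZfconj x₁ hx₁ x₀ hx₀

end Rat

end Congruence

end Summit.BirchSwinnertonDyer.Rank1Residual.GaloisImage

end
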